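import Summits.BirchSwinnertonDyer.Rank1Residual.ManinAdditive.ComponentExponentDegreeLaw
import Summits.BirchSwinnertonDyer.Rank1Residual.ManinAdditive.ComponentExponentEisensteinSplit
import HarnessLib

/-!
# Proved edges for the Eisenstein split of the component-exponent degree law (cell `bsd-f2-manin`,
# E-desc-3 / 7 / 8 / 9 / 9♯)

PROVED (no `sorry`, nothing new asserted), after the planner's HOME/desc/Sketch-desc-g1.lean 61107beb94eee554:

* `componentExponentDegreeLaw_iff_range_and_residue` : CEL ↔ (Eisenstein-range clauses) ∧ (wild residue);
* `wildOddStarFourLaw_of_wildOddStarEightLaw` : E-desc-9♯ ⟹ E-desc-9;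
* `wildOddStarFourLaw_of_wildResidue` : E-desc-8 ⟹ E-desc-9, given that an `I_n*` fibre at `q` forces
  `q² ∣ N` (additive reduction; taken as an explicit hypothesis — the Ogg–Saito link between the tree's
  `kodairaSymbolAt` and `conductorNorm` is not invoked here), using
  `KodairaSymbol.componentGroupExponent (I_n*) = 4` for odd `n`.
-/

noncomputable section

open scoped MatrixGroups ModularForm

open CongruenceSubgroup WeierstrassCurve
  Literature.NumberTheory.EllipticCurves Literature.NumberTheory.EllipticCurves.ModularForms
  Literature.NumberTheory.DiophantineGeometry

namespace Summit.BirchSwinnertonDyer.Rank1Residual.ManinAdditive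

/-- **The Eisenstein split:** CEL `↔` (Eisenstein-range clauses) `∧` (wild residue clauses). -/
theorem componentExponentDegreeLaw_iff_range_and_residue :
    ComponentExponentDegreeLaw ↔
      (ComponentExponentDegreeLawEisensteinRange ∧ ComponentExponentDegreeLawWildResidue) := by
  constructor
  · intro h
    refine ⟨?_, ?_⟩
    · intro W _ _ _ D hL hmin q hq _ ℓ hℓ hirr
      exact h W D hL hmin q hq ℓ hℓ hirr
    · intro W _ _ _ D hL hmin q hq _ _ ℓ hℓ hirr
      exact h W D hL hmin q hq ℓ hℓ hirr
  · rintro ⟨h7, h8⟩ W _ _ _ D hL hmin q hq ℓ hℓ hirr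
    by_cases hc : q ^ 2 ∣ W.conductorNorm ℤ ∧ q < 5
    · exact h8 W D hL hmin q hq hc.1 hc.2 ℓ hℓ hirr
    · refine h7 W D hL hmin q hq ?_ ℓ hℓ hirr
      by_cases hd : q ^ 2 ∣ W.conductorNorm ℤ
      · right
        have : ¬ q < 5 := fun hlt => hc ⟨hd, hlt⟩
        omega
      · exact Or.inl hd

/-- **E-desc-9♯ ⟹ E-desc-9** (`4 ∣ 8`). -/
theorem wildOddStarFourLaw_of_wildOddStarEightLaw (h : WildOddStarEightLaw) : WildOddStarFourLaw := by
  intro W _ _ _ D hL hmin q hq n h5 hn hK hirr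
  exact Nat.dvd_trans (by norm_num : 4 ∣ 8) (h W D hL hmin q hq n h5 hn hK hirr)

/-- **E-desc-8 ⟹ E-desc-9**, given that an `I_n*` fibre at `q` forces `q² ∣ N`
(`componentGroupExponent (I_n*) = 4` for odd `n`, `v₂ 4 = 2`). -/
theorem wildOddStarFourLaw_of_wildResidue (h : ComponentExponentDegreeLawWildResidue)
    (hsq : ∀ (W : WeierstrassCurve ℚ) [W.IsElliptic] (q : ℕ) (hq : q.Prime) (n : ℕ),
      W.kodairaSymbolAt ((Rat.HeightOneSpectrum.primesEquiv (R := ℤ)).symm ⟨q, hq⟩) =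
        KodairaSymbol.Istar n → q ^ 2 ∣ W.conductorNorm ℤ) :
    WildOddStarFourLaw := by
  intro W _ _ _ D hL hmin q hq n h5 hn hK hirr
  have h2 := h W D hL hmin q hq (hsq W q hq n hK) h5 2 Nat.prime_two hirr
  rw [hK, KodairaSymbol.componentGroupExponent_Istar_of_odd hn] at h2
  have h4 : padicValNat 2 4 = 2 := by
    have : (4 : ℕ) = 2 ^ 2 := by norm_num
    rw [this, padicValNat.prime_pow]
  simpa [h4] using h2

end Summit.BirchSwinnertonDyer.Rank1Residual.ManinAdditive

end
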